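import Literature.AlgebraicGeometry.HodgeTheory.MaxRationalSubHodgeStructureSupportedHodgeClasses
import HarnessLib

/-!
# `HC(X) ⟺ GHC(X, 2p, p)` for `2p ≤ dim X`; `HC(X × C)` and `HC(X × S)` for a THREEFOLD `X`, any curve `C`,
# any surface `S`: the pieces `H³(X) ⊗ H¹` and `H²(X) ⊠ T(S)` are all that is left

Family `hodge`, layer `Literature/AlgebraicGeometry/HodgeTheory`; lane `lit-hodgefound` (Track 2 foundations,
Layer A1/A4). THEOREMS ONLY (no definition, no named fact; D-0026). Sequel of
`MaxRationalSubHodgeStructureSupportedHodgeClasses` (Künneth pieces of coniveau `≥ q − 1` in bidegree `(2q, q)`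
are settled; the odd pieces of two surfaces), `MaxRationalSubHodgeStructureKunnethTranscendentalPieces` (the NS/T
splitting of the piece over `Hⁱ(X) ⊗ H²(S)`), `MaxRationalSubHodgeStructureKunnethLinePieces`
(`generalHodgePropertyFor_tensor_curve_iff`) and `MaxRationalSubHodgeStructureHardLefschetz`
(`GHC(X, k, r) ⟹ GHC(X, k + 2j, r + j)` for `k + j = dim X`).

Sources, VERBATIM. C. Voisin, J. Open Math. Probl. 1 (2025), §4.3 first paragraph: «In order to solve the
generalized Hodge conjecture for `L`, we can assume that `k ≤ n = dim X`, by the hard Lefschetz isomorphism […]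
If we solve the generalized Hodge conjecture for `L′`, then `L′` is supported on a subvariety of codimension
`≥ c − r` so `L = lʳ ⌣ L′` is supported on a subvariety of codimension `≥ c`»; §3.2.1 proof of Prop. 3.8 («the
class `δ₁ ∈ H^{2n−1}(X, ℚ) ⊗ H¹(X, ℚ)` belongs to `Im (j_* ⊗ Id …)` […] The Hodge conjecture being known for degree
2 Hodge classes, we conclude that `β` is algebraic»). A. Grothendieck, Topology 8 (1969), pp. 300–301. C. Voisin,
*Hodge Theory and Complex Algebraic Geometry I* (CUP 2002), §11.3.3 Thm. 11.38 / 11.40, p. 286 («The Künneth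
components of such a class are still Hodge classes»), §6.2.3 Thm. 6.25, §11.3.1 Thm. 11.30; *II* (CUP 2003),
§10.2.3 proof of Prop. 10.26 (the Hodge conjecture for curve classes on threefolds). D. Huybrechts, *Lectures on
K3 Surfaces* (CUP 2016), Ch. 3 §3.2–§3.3 (`T(S) = NS(S)^⊥`).

## The mathematics

(1) By hard Lefschetz for Grothendieck's `max` (`generalHodgePropertyFor_of_add_eq_dim`), `GHC(X, 2p, p)` for
`2p > n = dim X` is the image of `GHC(X, 2(n − p), n − p)`; so **`HC(X) ⟺ GHC(X, 2p, p)` for `2p ≤ dim X`**: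
fourfolds and FIVEFOLDS need only `GHC(X, 4, 2)`.

(2) THREEFOLD × CURVE (a fourfold): `HC(X × C) ⟺ GHC(X × C, 4, 2) ⟺` the component of `max(X × C, 4, 2)` over
`H³(X) ⊗ H¹(C)` lies in `N²` — the border piece `H⁴(X) ⊗ H⁰(C)` is `GHC(X, 4, 2)` (curve classes on a threefold)
and `H²(X) ⊗ H²(C)` is the line piece settled by `GHC(X, 2, 1)` (`generalHodgePropertyFor_tensor_curve_iff`).

(3) THREEFOLD × SURFACE (a fivefold): `HC(X × S) ⟺ GHC(X × S, 4, 2)` (by (1)); its Künneth components: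
`H⁴(X) ⊗ H⁰(S)` and `H⁰(X) ⊗ H⁴(S)` over algebraic cohomology (`GHC(X, 4, 2)`, `GHC(X, 0, 0)`);
`H¹(X) ⊗ H³(S)` has coniveau `1 = 2 − 1` (`H³(S)` is carried by curves) and is settled by the prequel
(Hodge classes of coniveau `≥ q − 1` are algebraic); `H²(X) ⊗ H²(S)` splits into its Néron–Severi part (settled
by `GHC(X, 2, 1)`) and its transcendental part `H²(X) ⊠ T(S)_ℂ`; `H³(X) ⊗ H¹(S)` (coniveau `0`) remains. Hence
**`HC(X × S) ⟺ [max(4, 2) ∩ (H³(X) ⊗ H¹(S)) ⊆ N²] ∧ [max(4, 2) ∩ (H²(X) ⊠ T(S)_ℂ) ⊆ N²]`** for ANY smooth projective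
threefold `X` and ANY smooth projective surface `S` — the bidegree-`(6, 3)` condition of the prequel's
`hodgeConjectureFor_threefold_tensor_surface_iff_transcendental` is the hard-Lefschetz image of `(4, 2)` and its
hypothesis `H¹(S) = H³(S) = 0` only served to kill the two odd pieces, one of which is free.

## What is proved

* §1 **`hodgeConjectureFor_iff_forall_generalHodgePropertyFor_two_mul_le`** (`HC(X) ⟺ ∀ p, 2p ≤ n → GHC(X, 2p, p)`),
  `hodgeConjectureFor_iff_generalHodgePropertyFor_four_two_of_dim_four`, `…_of_dim_five`.
* §2 **`hodgeConjectureFor_threefold_tensor_curve_iff`** (`HC(X × C) ⟺` the `H³(X) ⊗ H¹(C)` piece).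
* §3 **`hodgeConjectureFor_threefold_tensor_surface_iff_odd_and_transcendental`** (`HC(X × S) ⟺` the
  `H³(X) ⊗ H¹(S)` piece and the `H²(X) ⊠ T(S)` piece), `…_of_subsingleton_three` (`H³(X) = 0`: only the
  transcendental piece), `…_of_subsingleton_one` (`H¹(S) = 0`: only the transcendental piece — the prequel's theorem
  without `H³(S) = 0` and without its `(6, 3)` condition), `…_of_algebraicClasses_eq_top` (`NS(S) = H²(S)`: only
  the `H³(X) ⊗ H¹(S)` piece), `hodgeConjectureFor_threefold_tensor_surface_of_subsingleton_three_of_algebraicClasses_eq_top`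
  (`H³(X) = 0` and `p_g(S) = 0`: `HC(X × S)` outright).

## References

* [Voisin2025] C. Voisin, Hodge and generalized Hodge conjectures, coniveau and algebraic cycles, J. Open Math.
  Probl. 1 (2025), §4.3 (first paragraph), §3.2.1 Prop. 3.8 (proof), §4.1 Def. 4.1.
* [GrothendieckTopology1969] A. Grothendieck, Hodge's general conjecture is false for trivial reasons, Topology 8
  (1969) 299–303, pp. 300–301.
* [VoisinHodgeI2002] C. Voisin, Hodge Theory and Complex Algebraic Geometry I (CUP 2002), §11.3.3 Thm. 11.38,
  Thm. 11.40, p. 286; §6.2.3 Thm. 6.25; §11.3.1 Thm. 11.30.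
* [VoisinHodgeII2003] C. Voisin, Hodge Theory and Complex Algebraic Geometry II (CUP 2003), §10.2.3 proof of
  Prop. 10.26.
* [Voisin2013GHCBloch] C. Voisin, The generalized Hodge and Bloch conjectures are equivalent for general complete
  intersections, Ann. Sci. ÉNS 46 (2013), Lemma 2.1 (proof).
* [Huybrechts2016K3] D. Huybrechts, Lectures on K3 Surfaces (CUP 2016), Ch. 3 §3.2–§3.3.
-/

noncomputable section

open CategoryTheory AlgebraicGeometry MonoidalCategory CartesianMonoidalCategory Finset
open Literature.AlgebraicTopology.SingularHomology
open Literature.Geometry.Kaehler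
open Literature.AlgebraicGeometry.Motives (IsSmoothProjective ComplexPoints)

namespace Literature.AlgebraicGeometry.HodgeTheory

variable {n m : ℕ} {X Y : Motives.SchemeOver ℂ}

/-! ### §1 `HC(X) ⟺ GHC(X, 2p, p)` for `2p ≤ dim X` -/

/-- **`HC(X) ⟺ GHC(X, 2p, p)` for the `p` with `2p ≤ dim X`**: for `2p > n` the bidegree `(2p, p)` is the
hard-Lefschetz image `(k + 2j, r + j)` of `(k, r) = (2(n − p), n − p)`, `j = 2p − n`, `k + j = n`
(`generalHodgePropertyFor_of_add_eq_dim`), or lies in the Lefschetz range `n ≤ p + 1`.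
[cite: Voisin2025, §4.3 (first paragraph)] [cite: GrothendieckTopology1969, pp. 300–301]
[cite: VoisinHodgeI2002, §6.2.3 Thm. 6.25 and §11.3.1 Thm. 11.30] -/
theorem hodgeConjectureFor_iff_forall_generalHodgePropertyFor_two_mul_le (hX : IsSmoothProjective n X) :
    HodgeConjectureFor n X ↔ ∀ p : ℕ, 2 * p ≤ n → GeneralHodgePropertyFor n X (2 * p) p := by
  rw [hodgeConjectureFor_iff_forall_generalHodgePropertyFor hX]
  refine ⟨fun h p _ ↦ h p, fun h p ↦ ?_⟩
  by_cases hp : 2 * p ≤ n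
  · exact h p hp
  by_cases hp' : p ≤ 1 ∨ n ≤ p + 1
  · exact generalHodgePropertyFor_two_mul_self_of_lefschetzRange hX hp'
  · have h' := generalHodgePropertyFor_of_add_eq_dim hX (show 2 * (n - p) + (2 * p - n) = n by omega)
      (h (n - p) (by omega))
    rwa [show 2 * (n - p) + 2 * (2 * p - n) = 2 * p by omega, show n - p + (2 * p - n) = p by omega] at h'

/-- **FOURFOLDS: `HC(X) ⟺ GHC(X, 4, 2)`** (codimensions `≠ 2` are in the Lefschetz range).
[cite: GrothendieckTopology1969, p. 301] [cite: VoisinHodgeI2002, §11.3.1 Thm. 11.30 and §6.2.3 Thm. 6.25] -/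
theorem hodgeConjectureFor_iff_generalHodgePropertyFor_four_two_of_dim_four (hX : IsSmoothProjective 4 X) :
    HodgeConjectureFor 4 X ↔ GeneralHodgePropertyFor 4 X (2 * 2) 2 := by
  rw [hodgeConjectureFor_iff_forall_generalHodgePropertyFor_two_mul_le hX]
  refine ⟨fun h ↦ h 2 (by omega), fun h p hp ↦ ?_⟩
  by_cases hp' : p ≤ 1 ∨ 4 ≤ p + 1
  · exact generalHodgePropertyFor_two_mul_self_of_lefschetzRange hX hp'
  · obtain rfl : p = 2 := by omega
    exact h

/-- **FIVEFOLDS: `HC(X) ⟺ GHC(X, 4, 2)`** — codimension `3` is the hard-Lefschetz image of codimension `2`,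
codimensions `≤ 1` and `≥ 4` are in the Lefschetz range. [cite: Voisin2025, §4.3 (first paragraph)]
[cite: GrothendieckTopology1969, p. 301] [cite: VoisinHodgeI2002, §6.2.3 Thm. 6.25 and §11.3.1 Thm. 11.30] -/
theorem hodgeConjectureFor_iff_generalHodgePropertyFor_four_two_of_dim_five (hX : IsSmoothProjective 5 X) :
    HodgeConjectureFor 5 X ↔ GeneralHodgePropertyFor 5 X (2 * 2) 2 := by
  rw [hodgeConjectureFor_iff_forall_generalHodgePropertyFor_two_mul_le hX]
  refine ⟨fun h ↦ h 2 (by omega), fun h p hp ↦ ?_⟩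
  by_cases hp' : p ≤ 1 ∨ 5 ≤ p + 1
  · exact generalHodgePropertyFor_two_mul_self_of_lefschetzRange hX hp'
  · obtain rfl : p = 2 := by omega
    exact h

/-! ### §2 Threefold × curve -/

/-- **`HC(X × C)` FOR A SMOOTH PROJECTIVE THREEFOLD `X` AND A SMOOTH PROJECTIVE CURVE `C` ⟺ THE `H³(X) ⊗ H¹(C)`
PIECE**: `HC(X × C) ⟺ GHC(X × C, 4, 2)`, whose border piece `H⁴(X) ⊗ H⁰(C)` is `GHC(X, 4, 2)` (the Hodge
conjecture for curve classes on the threefold `X`, known) and whose piece `H²(X) ⊗ H²(C)` is settled by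
`GHC(X, 2, 1)` (`generalHodgePropertyFor_tensor_curve_iff`); what remains is the part of `max(X × C, 4, 2)` — the
span of the Hodge classes of `H⁴(X × C)` — inside `H³(X) ⊗ H¹(C)`. [cite: GrothendieckTopology1969, pp. 300–301]
[cite: VoisinHodgeII2003, §10.2.3 proof of Prop. 10.26] [cite: VoisinHodgeI2002, §11.3.3 Thm. 11.38 and p. 286] -/
theorem hodgeConjectureFor_threefold_tensor_curve_iff (hX : IsSmoothProjective 3 X) (hC : IsSmoothProjective 1 Y)
    (C : HodgeModel (3 + 1) (X ⊗ Y)) :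
    HodgeConjectureFor (3 + 1) (X ⊗ Y) ↔
      C.maxRatSubHodgeInFilt (2 * 2) 2 ⊓ kunnethPiece X Y (show 3 + 1 = 2 * 2 by omega) ≤
        supportedClasses (X ⊗ Y) (2 * 2) 2 := by
  have hXC := hX.tensor_holds hC
  have h := generalHodgePropertyFor_tensor_curve_iff hX hC C 2 1
  refine (hodgeConjectureFor_iff_generalHodgePropertyFor_four_two_of_dim_four hXC).trans
    ⟨fun h42 ↦ (h.1 h42).2.2 (by omega), fun hP ↦ h.2 ⟨?_, generalHodgePropertyFor_two_one hX, fun _ ↦ hP⟩⟩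
  exact generalHodgePropertyFor_of_dim_three hX (Or.inl (by omega))

/-! ### §3 Threefold × surface -/

/-- **`HC(X × S)` FOR A SMOOTH PROJECTIVE THREEFOLD `X` AND A SMOOTH PROJECTIVE SURFACE `S` ⟺ THE PIECES
`H³(X) ⊗ H¹(S)` AND `H²(X) ⊠ T(S)_ℂ` OF `max(X × S, 4, 2)`** (no hypothesis on `X`, `S`). `HC(X × S) ⟺ GHC(X × S, 4, 2)`
(§1); the components of `max(4, 2)` over `H⁴(X) ⊗ H⁰(S)`, `H⁰(X) ⊗ H⁴(S)` (algebraic cohomology, `GHC(X, 4, 2)`),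
`H¹(X) ⊗ H³(S)` (coniveau `1`, Hodge classes of coniveau `≥ 1` in degree `4` are algebraic) and the Néron–Severi part
of `H²(X) ⊗ H²(S)` (`GHC(X, 2, 1)`) are supported in codimension `2` unconditionally.
[cite: GrothendieckTopology1969, pp. 300–301] [cite: Voisin2025, §3.2.1 Prop. 3.8 (proof) and §4.3]
[cite: Voisin2013GHCBloch, Lemma 2.1 (proof)] [cite: Huybrechts2016K3, Ch. 3 §3.2–§3.3]
[cite: VoisinHodgeII2003, §10.2.3 proof of Prop. 10.26] -/
theorem hodgeConjectureFor_threefold_tensor_surface_iff_odd_and_transcendental {S : Motives.SchemeOver ℂ}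
    (hX : IsSmoothProjective 3 X) (hS : IsSmoothProjective 2 S) (C : HodgeModel (3 + 2) (X ⊗ S)) :
    HodgeConjectureFor (3 + 2) (X ⊗ S) ↔
      C.maxRatSubHodgeInFilt (2 * 2) 2 ⊓ kunnethPiece X S (show 3 + 1 = 2 * 2 by omega) ≤
          supportedClasses (X ⊗ S) (2 * 2) 2 ∧
        C.maxRatSubHodgeInFilt (2 * 2) 2 ⊓ Submodule.map₂
            ((cupProduct (show 2 + 2 * 1 = 2 * 2 by omega)).compl₁₂ (complexBetti.map (fst X S) 2).hom
              (complexBetti.map (snd X S) (2 * 1)).hom) ⊤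
            (LinearMap.BilinForm.orthogonal
              (cupPairing (complexOrientationFamily hS) (show 2 * 1 + 2 * 1 = 2 * 2 by omega)) (algebraicClasses S 1)) ≤
          supportedClasses (X ⊗ S) (2 * 2) 2 := by
  classical
  have hXS := hX.tensor_holds hS
  refine ⟨fun h ↦ ⟨h.maxRatSubHodgeInFilt_inf_le_supportedClasses hXS C 2 _,
    h.maxRatSubHodgeInFilt_inf_le_supportedClasses hXS C 2 _⟩, fun ⟨h31, hT⟩ ↦ ?_⟩
  refine (hodgeConjectureFor_iff_generalHodgePropertyFor_four_two_of_dim_five hXS).2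
    ((generalHodgePropertyFor_tensor_iff_forall_inf_kunnethPiece_le' hX hS C (2 * 2) 2).2 fun i j hk ↦ ?_)
  rcases Nat.even_or_odd j with ⟨b, hb⟩ | hj
  · rcases Nat.lt_or_ge 2 b with hb2 | hb2
    · haveI := subsingleton_complexBetti hS (show 2 * 2 < j by omega)
      rw [kunnethPiece_eq_bot_of_subsingleton hk, inf_bot_eq]
      exact bot_le
    · rcases (show b = 0 ∨ b = 1 ∨ b = 2 by omega) with rfl | rfl | rfl
      · obtain rfl : j = 2 * 0 := by omega
        obtain rfl : i = 4 := by omega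
        exact maxRatSubHodgeInFilt_inf_kunnethPiece_le_supportedClasses_of_algebraic hX hS C (show 0 + 2 = 2 by rfl)
          hk (supportedClasses_zero S _) (supportedClasses_eq_top_of_dim_add_le hS (by omega))
          fun _ ↦ generalHodgePropertyFor_of_dim_three hX (Or.inl (by omega))
      · obtain rfl : j = 2 * 1 := by omega
        obtain rfl : i = 2 := by omega
        exact (maxRatSubHodgeInFilt_inf_kunnethPiece_le_supportedClasses_iff_transcendental hX hS C hk
          fun _ ↦ generalHodgePropertyFor_of_dim_three hX (Or.inl (by omega))).2 hT
      · obtain rfl : j = 2 * 2 := by omega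
        obtain rfl : i = 0 := by omega
        exact maxRatSubHodgeInFilt_inf_kunnethPiece_le_supportedClasses_of_algebraic hX hS C (show 2 + 0 = 2 by rfl)
          hk (supportedClasses_eq_top_of_dim_add_le hS (by omega)) (supportedClasses_zero S _)
          fun _ ↦ generalHodgePropertyFor_of_dim_three hX (Or.inl (by omega))
  · have hj' : j = 1 ∨ j = 3 ∨ 2 * 2 < j := by obtain ⟨t, rfl⟩ := hj; omega
    rcases hj' with rfl | rfl | hj4
    · obtain rfl : i = 3 := by omega
      exact h31
    · obtain rfl : i = 1 := by omega
      exact maxRatSubHodgeInFilt_inf_kunnethPiece_le_supportedClasses_of_pred_le hX hS C hk (show 1 + 1 = 2 by rfl)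
        (by decide)
    · haveI := subsingleton_complexBetti hS hj4
      rw [kunnethPiece_eq_bot_of_subsingleton hk, inf_bot_eq]
      exact bot_le

/-- **Threefolds with `H³(X) = 0`** (`b₃ = 0`: `ℙ³`, quadrics, `V₅`, `V₂₂`, …) **times any surface:
`HC(X × S) ⟺` the `H²(X) ⊠ T(S)_ℂ` piece.** [cite: GrothendieckTopology1969, pp. 300–301]
[cite: Huybrechts2016K3, Ch. 3 §3.2–§3.3] [cite: Voisin2025, §3.2.1 Prop. 3.8 (proof) and §4.3] -/
theorem hodgeConjectureFor_threefold_tensor_surface_iff_transcendental_of_subsingleton_three {S : Motives.SchemeOver ℂ}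
    (hX : IsSmoothProjective 3 X) (hS : IsSmoothProjective 2 S) [Subsingleton (complexBetti X 3)]
    (C : HodgeModel (3 + 2) (X ⊗ S)) :
    HodgeConjectureFor (3 + 2) (X ⊗ S) ↔
      C.maxRatSubHodgeInFilt (2 * 2) 2 ⊓ Submodule.map₂
          ((cupProduct (show 2 + 2 * 1 = 2 * 2 by omega)).compl₁₂ (complexBetti.map (fst X S) 2).hom
            (complexBetti.map (snd X S) (2 * 1)).hom) ⊤
          (LinearMap.BilinForm.orthogonal
            (cupPairing (complexOrientationFamily hS) (show 2 * 1 + 2 * 1 = 2 * 2 by omega)) (algebraicClasses S 1)) ≤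
        supportedClasses (X ⊗ S) (2 * 2) 2 := by
  rw [hodgeConjectureFor_threefold_tensor_surface_iff_odd_and_transcendental hX hS C]
  simp only [kunnethPiece_eq_bot_of_subsingleton_left, inf_bot_eq, bot_le, true_and]

/-- **Threefold × REGULAR surface (`H¹(S) = 0`): `HC(X × S) ⟺` the `H²(X) ⊠ T(S)_ℂ` piece at `(4, 2)`** — the
prequel's `hodgeConjectureFor_threefold_tensor_surface_iff_transcendental` without its hypothesis `H³(S) = 0` and
without its bidegree-`(6, 3)` condition. [cite: GrothendieckTopology1969, pp. 300–301]
[cite: Huybrechts2016K3, Ch. 3 §3.2–§3.3] [cite: Voisin2025, §4.3 (first paragraph)] -/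
theorem hodgeConjectureFor_threefold_tensor_surface_iff_transcendental_of_subsingleton_one {S : Motives.SchemeOver ℂ}
    (hX : IsSmoothProjective 3 X) (hS : IsSmoothProjective 2 S) [Subsingleton (complexBetti S 1)]
    (C : HodgeModel (3 + 2) (X ⊗ S)) :
    HodgeConjectureFor (3 + 2) (X ⊗ S) ↔
      C.maxRatSubHodgeInFilt (2 * 2) 2 ⊓ Submodule.map₂
          ((cupProduct (show 2 + 2 * 1 = 2 * 2 by omega)).compl₁₂ (complexBetti.map (fst X S) 2).hom
            (complexBetti.map (snd X S) (2 * 1)).hom) ⊤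
          (LinearMap.BilinForm.orthogonal
            (cupPairing (complexOrientationFamily hS) (show 2 * 1 + 2 * 1 = 2 * 2 by omega)) (algebraicClasses S 1)) ≤
        supportedClasses (X ⊗ S) (2 * 2) 2 := by
  rw [hodgeConjectureFor_threefold_tensor_surface_iff_odd_and_transcendental hX hS C]
  simp only [kunnethPiece_eq_bot_of_subsingleton, inf_bot_eq, bot_le, true_and]

/-- **Threefold × surface with `NS(S)_ℂ = H²(S)`** (`p_g(S) = 0`): `HC(X × S) ⟺` the `H³(X) ⊗ H¹(S)` piece.
[cite: GrothendieckTopology1969, pp. 300–301] [cite: VoisinHodgeI2002, §11.3.1 Thm. 11.30 and §11.3.3]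
[cite: Hartshorne1977, V Thm. 1.9 and V Rem. 1.9.1] -/
theorem hodgeConjectureFor_threefold_tensor_surface_iff_odd_of_algebraicClasses_eq_top {S : Motives.SchemeOver ℂ}
    (hX : IsSmoothProjective 3 X) (hS : IsSmoothProjective 2 S) (C : HodgeModel (3 + 2) (X ⊗ S))
    (h : algebraicClasses S 1 = ⊤) :
    HodgeConjectureFor (3 + 2) (X ⊗ S) ↔
      C.maxRatSubHodgeInFilt (2 * 2) 2 ⊓ kunnethPiece X S (show 3 + 1 = 2 * 2 by omega) ≤
        supportedClasses (X ⊗ S) (2 * 2) 2 := by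
  have hT : LinearMap.BilinForm.orthogonal
      (cupPairing (complexOrientationFamily hS) (show 2 * 1 + 2 * 1 = 2 * 2 by omega)) (algebraicClasses S 1) = ⊥ := by
    have hc := (isCompl_algebraicClasses_orthogonal hS).inf_eq_bot
    rw [h] at hc ⊢
    rwa [top_inf_eq] at hc
  rw [hodgeConjectureFor_threefold_tensor_surface_iff_odd_and_transcendental hX hS C, hT, Submodule.map₂_bot_right,
    inf_bot_eq]
  simp only [bot_le, and_true]

/-- **`HC(X × S)` OUTRIGHT for a threefold with `H³(X) = 0` and a surface with `NS(S)_ℂ = H²(S)`** (e.g. a Fano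
threefold with `b₃ = 0` times an Enriques or a rational surface). [cite: GrothendieckTopology1969, pp. 300–301]
[cite: VoisinHodgeI2002, §11.3.1 Thm. 11.30 and §11.3.3] -/
theorem hodgeConjectureFor_threefold_tensor_surface_of_subsingleton_three_of_algebraicClasses_eq_top
    {S : Motives.SchemeOver ℂ} (hX : IsSmoothProjective 3 X) (hS : IsSmoothProjective 2 S)
    [Subsingleton (complexBetti X 3)] (h : algebraicClasses S 1 = ⊤) : HodgeConjectureFor (3 + 2) (X ⊗ S) := by
  obtain ⟨C⟩ := nonempty_hodgeModel_holds (hX.tensor_holds hS)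
  rw [hodgeConjectureFor_threefold_tensor_surface_iff_odd_of_algebraicClasses_eq_top hX hS C h]
  simp only [kunnethPiece_eq_bot_of_subsingleton_left, inf_bot_eq, bot_le]

end Literature.AlgebraicGeometry.HodgeTheory

end
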